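import Summits.BirchSwinnertonDyer.BirchSwinnertonDyer.Theorems.ManinLocalTwoThreeKLineMinimalDictionaryC
import Summits.BirchSwinnertonDyer.BirchSwinnertonDyer.Theorems.ManinLocalTwoThreeKummerMinimalParamPresentation
import Summits.BirchSwinnertonDyer.BirchSwinnertonDyer.Theorems.ManinLocalTwoThreeKummerWitnessExtensionB
import Summits.BirchSwinnertonDyer.BirchSwinnertonDyer.Theorems.ManinLocalTwoThreeKummerWitnessInvarianceB
import Summits.BirchSwinnertonDyer.BirchSwinnertonDyer.Theorems.ManinLocalTwoThreeQExpansionExtension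
import Summits.BirchSwinnertonDyer.BirchSwinnertonDyer.Theorems.ManinLocalTwoThreeIntegralQSeriesNearCuspB
import Summits.BirchSwinnertonDyer.BirchSwinnertonDyer.Theorems.ManinLocalTwoThreeKummerCoverSubgroup
import Summits.BirchSwinnertonDyer.BirchSwinnertonDyer.Theorems.ManinLocalTwoThreeUnboundedDenominatorsWeightAlgIntOfCDT
import Summits.BirchSwinnertonDyer.Rank1Residual.ManinAdditive.UDCKummerLineK
import HarnessLib

/-!
# The `K`-rational Kummer/UDC line: (AN♮)_K ASSEMBLED modulo (INT)_K — the Kummer character of a `K`-rational point of order `3` is CONGRUENCE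
# once its minimal cube root has algebraic-integer coefficients (up to a power of `3`), given Unbounded Denominators with algebraic-integer coefficients
(route `ManinLocalTwoThree`, crux C3 `ManinPrimeToThreeAtNine` stmt-BirchSwinnertonDyer-22968 — residual RES₃♭, -an g39's `K`-line MEMO-an §82,
node (AN♮)_K `KummerCubeRootCongruenceOfBoundedKOfUDC := (∀ k, UnboundedDenominatorsWeightAlgInt k) → KummerCubeRootCongruenceOfBoundedK`;
cell bsd-f2-manin, prover seat p2 gen 18; `--supports stmt-BirchSwinnertonDyer-22968`)

The B-LINE of the C3 witness law, RE-RUN for the `K`-rational point `T = (X₀, Y₀)` (`X₀ ∈ ℚ`, `Y₀ ∈ ℂ`) of -an g39's `K`-line, DEF-FREE (an's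
`ManinAdditive.UDCKummerLineK` is not in the tree yet; every statement below is over tree declarations, with the tangent-line Kummer series
and slope written out — an's `kummerCubeSeriesC` / `tangentSlopeC` are the instances `α := (3X₀² + a₄)/(2Y₀)` by `rfl` — and with
`UnboundedDenominatorsWeightAlgInt k` / `IsThreeAdicallyBoundedAlg` replaced by their bodies):

* §1 **(QEXNB) with algebraic-integer coefficients** `integralQSeriesNearCuspB_algInt`: `Φ = Σ φₘqᵐ` (`φₘ ∈ ℤ̄`) for `Im τ > B`, `B_d = Σ bₙe^{2πiτn}`
  (`bₙ ∈ ℤ`) on `ℍ`, `F = B_d·Φ` for `Im τ > B'` ⟹ `F = Σ b'ₘe^{2πiτm}`, `b'ₘ ∈ ℤ̄` (Cauchy product; `IsIntegral.sum/.mul`).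
* §2 **the witness** `exists_kummerWitness_algInt`: for a lift `u` of `T`, THE germ `z`, a complex cube root `h` of `Θ_T` (`h(0) = −1`) and a minimal
  renormalisation `g` (`c·(z·g) = z_W·h`) with `3^{K'}·gₙ ∈ ℤ̄` for all `n` — the OUTPUT SHAPE of (INT)_K —, there are a weight `k` and a holomorphic
  `F : ℍ → ℂ` whose `Γ₀(N)`-stabiliser under `∣[k]` is EXACTLY `KummerPeriodTrivial D u ·`, of exponential growth at every cusp, with a `q`-expansion
  on all of `ℍ` whose coefficients are ALGEBRAIC INTEGERS: `F = 3^{K'}κ·B_d·kummerMinBlock` from (DICT)_ℂ `KLine.kummerMinimalDictionaryC` (p2, engines II),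
  (RATB) `ParamPoleJ.kummerMinimalParamPresentation_holds` (p3, p733689 — `T`-free), (HOLB) `WitnessInvariance.kummerMinimalWitnessExtensionB_holds`
  and (INVB) `…kummerMinimalWitnessInvarianceB_holds` (p2, p731758/p731884 — stated for an arbitrary lift `u`), §1, and the C3 LEAD's (QXP)
  `QExpansionExtension.hasSum_exp_of_hasSum_of_lt_im` (p729478).
* §3 **the glue** `kummerCongruence_of_witness_algInt`: such a witness plus `∀ k, UnboundedDenominatorsWeightAlgInt k` (body inline) gives
  `∃ M ≥ 1, ∀ γ ∈ Γ₀(N) ∩ Γ(M), KummerPeriodTrivial D u γ` (the C3 LEAD's `UDCGlue` p727487 with NC-a `kummerCoverSubgroup_holds`, p725557).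
* §4 **(AN♮)_K modulo (INT)_K** `kummerCongruenceK_of_UDW_algInt_of_minimalCubeRoot`: §2 ∘ §3; `…_of_CDT_algInt_…` with the UDC input discharged from
  the vendored `CalegariDimitrovTang2025_unboundedDenominators_algInt` by p2's `unboundedDenominatorsWeightAlgInt_of_CDT_algInt` (p734175).
* §5 **BY NAME on an's landed `ManinAdditive.UDCKummerLineK` (ty g21, T-an-47)**: `unboundedDenominatorsWeightAlgInt_of_CDT_algInt'`
  (`∀ k, UnboundedDenominatorsWeightAlgInt k` ⟸ CDT), and **`kummerCubeRootCongruenceOfBoundedKOfUDC_of_minimalCubeRootK :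
  MinimalCubeRootK-shape → KummerCubeRootCongruenceOfBoundedKOfUDC`** / `kummerCubeRootCongruenceOfBoundedK_of_CDT_algInt_of_minimalCubeRootK`, where the
  hypothesis is (INT)_K in the EXACT interface p3 g16 is proving (STATUS 2026-08-29T17:08:53Z): from `IsShortThreeTorsionC`, `h³ = kummerCubeSeriesC`,
  `h(0) = −1`, `IsThreeAdicallyBoundedAlg h` produce `g, K'` with `3^{K'}gₙ ∈ ℤ̄`, `g(0) = −1`, `c·(z·g) = z_W·h`.  So (AN♮)_K is ONE named piece away.

HONEST FRAMING.  (AN♮)_K is NOT closed here ((INT)_K outstanding); KLINE needs also (BI)_K and (NCΣ); RES₃♭ needs EXISTC, GENΣ, RESΣ; C3, Manin's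
conjecture and BSD are NOT proved.  No definitions, no sorry, no new axioms. [folklore]
[cite: CalegariDimitrovTang2025, Thm. 1.0.1 and Remarks 58–59 (the printed input, consumed as the hypothesis `hUDW`)]
-/

set_option autoImplicit false
-- lint-debt: the directory name repeats the summit name (sibling precedent `ManinLocalTwoThreeUDCGlue.lean`)
set_option linter.dupNamespace false

noncomputable section

open scoped Topology PeriodPair MatrixGroups ModularForm Manifold
open Complex Filter PowerSeries CongruenceSubgroup
open UpperHalfPlane hiding I
open WeierstrassCurve Literature.NumberTheory.EllipticCurves Literature.NumberTheory.EllipticCurves.ModularForms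
open Summit.BirchSwinnertonDyer.Rank1Residual.ManinAdditive.CuspidalKummer
open Summit.BirchSwinnertonDyer.Rank1Residual.ManinAdditive.CuspidalKummerThree
open Summit.BirchSwinnertonDyer.Rank1Residual.ManinAdditive.KummerCubeMonodromy
open Summit.BirchSwinnertonDyer.Rank1Residual.ManinAdditive.UDCKummerLine
open Summit.BirchSwinnertonDyer.Rank1Residual.ManinAdditive.UDCKummerWitnessLine
open Summit.BirchSwinnertonDyer.BirchSwinnertonDyer.Theorems.ManinLocalTwoThree.IntegralQSeries
  (hasSum_intSeries_of_hasSum_exp)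

namespace Summit.BirchSwinnertonDyer.BirchSwinnertonDyer.Theorems.ManinLocalTwoThree.KLine

variable {W : WeierstrassCurve ℚ} {N : ℕ} [NeZero N]

/-! ### §1 (QEXNB) with algebraic-integer coefficients -/

/-- **(QEXNB), algebraic-integer coefficients**: `Φ = Σ φₘ𝕢₁(τ)ᵐ` (`φₘ` algebraic integers) for `Im τ > B`, `B_d = Σ bₙe^{2πiτn}` (`bₙ ∈ ℤ`) on `ℍ`,
`F = B_d·Φ` for `Im τ > B'` ⟹ `F = Σ b'ₘe^{2πiτm}` for `Im τ > max B B'` with every `b'ₘ` an algebraic integer. [folklore] -/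
theorem integralQSeriesNearCuspB_algInt (Φ F Bd : ℍ → ℂ) (φ : ℕ → ℂ) (bd : ℕ → ℤ)
    (hφ : ∀ m, IsIntegral ℤ (φ m))
    (hΦ : ∃ B : ℝ, ∀ τ : ℍ, B < τ.im → HasSum (fun m : ℕ ↦ φ m * Function.Periodic.qParam 1 (τ : ℂ) ^ m) (Φ τ))
    (hBd : ∀ τ : ℍ, HasSum (fun n : ℕ ↦ (bd n : ℂ) * Complex.exp (2 * Real.pi * Complex.I * (τ : ℂ) * n)) (Bd τ))
    (hF : ∃ B : ℝ, ∀ τ : ℍ, B < τ.im → F τ = Bd τ * Φ τ) :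
    ∃ (b : ℕ → ℂ) (B : ℝ), (∀ m, IsIntegral ℤ (b m)) ∧ ∀ τ : ℍ, B < τ.im →
      HasSum (fun m : ℕ ↦ b m * Complex.exp (2 * Real.pi * Complex.I * (τ : ℂ) * m)) (F τ) := by
  obtain ⟨B₁, hB₁⟩ := hΦ
  obtain ⟨B₂, hB₂⟩ := hF
  set P : PowerSeries ℂ := PowerSeries.mk φ with hP
  set K : PowerSeries ℂ := (PowerSeries.mk bd).map (Int.castRingHom ℂ) with hK
  refine ⟨fun m ↦ coeff m (K * P), max B₁ B₂, fun m ↦ ?_, fun τ hτ ↦ ?_⟩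
  · show IsIntegral ℤ (coeff m (K * P))
    rw [PowerSeries.coeff_mul]
    refine IsIntegral.sum _ fun ij _ ↦ IsIntegral.mul ?_ ?_
    · rw [hK, PowerSeries.coeff_map, eq_intCast]
      exact isIntegral_algebraMap (R := ℤ) (A := ℂ) (x := coeff ij.1 (PowerSeries.mk bd))
    · rw [hP, PowerSeries.coeff_mk]; exact hφ ij.2
  · have h1 : B₁ < τ.im := lt_of_le_of_lt (le_max_left _ _) hτ
    have h2 : B₂ < τ.im := lt_of_le_of_lt (le_max_right _ _) hτ
    have hΦτ : HasSum (fun m : ℕ ↦ coeff m P * Function.Periodic.qParam 1 (τ : ℂ) ^ m) (Φ τ) := by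
      convert hB₁ τ h1 using 2 with m
      rw [hP, PowerSeries.coeff_mk]
    have hprod := KummerCubeSigmaLeaves.hasSum_coeff_mul_pow_mul (hasSum_intSeries_of_hasSum_exp (hBd τ)) hΦτ
    rw [← hB₂ τ h2] at hprod
    convert hprod using 2 with m
    rw [QExpansionExtension.exp_eq_qParam_pow]

/-! ### §2 The witness with algebraic-integer `q`-expansion -/

/-- **The `K`-rational Kummer witness.**  For a lift `u ∉ Λ` (`3u ∈ Λ`) of the point `T = (X₀, Y₀)` (`c²℘(u) = X₀`, `c³℘'(u)/2 = Y₀`), THE germ `z`,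
a complex formal cube root `h` of the tangent-line Kummer series (slope `α = (3X₀² + a₄)/(2Y₀)`, `h(0) = −1`) and a minimal renormalisation `g`
(`c·(z·g) = z_W·h`) with `3^{K'}gₙ` algebraic integers: a weight `k` and a holomorphic `F` on `ℍ` with `Γ₀(N)`-stabiliser EXACTLY the Kummer
group of `u`, exponential growth at every cusp, and a `q`-expansion on `ℍ` with ALGEBRAIC-INTEGER coefficients
(`F = 3^{K'}κ·B_d·kummerMinBlock`). [folklore] -/
theorem exists_kummerWitness_algInt [W.IsElliptic] [W.IsGloballyMinimal]
    (D : ModularParametrizationData W N) (a : ℕ → ℤ) (ha : ∀ n, (a n : ℂ) = cuspCoeff D.f n)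
    (X₀ : ℚ) (Y₀ : ℂ) {u : ℂ} (hu : u ∉ D.L.lattice) (h3u : 3 * u ∈ D.L.lattice)
    (hX : (D.c : ℂ) ^ 2 * ℘[D.L] u = (X₀ : ℂ)) (hY : (D.c : ℂ) ^ 3 * ℘'[D.L] u / 2 = Y₀)
    (z : ℚ⟦X⟧) (hz : IsParamGerm W D.c a z) (h : ℂ⟦X⟧)
    (hh3 : h ^ 3 = PowerSeries.map (algebraMap ℚ ℂ) ((shortModel W D.c).formalYMulCube.subst z)
            - Y₀ • PowerSeries.map (algebraMap ℚ ℂ) (z ^ 3)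
            - ((3 * (X₀ : ℂ) ^ 2 + ((shortModel W D.c).a₄ : ℂ)) / (2 * Y₀)) •
                PowerSeries.map (algebraMap ℚ ℂ) ((shortModel W D.c).formalXMulSq.subst z * z - X₀ • z ^ 3))
    (hh0 : constantCoeff h = -1) (g : ℂ⟦X⟧) (K' : ℕ) (hgint : ∀ n, IsIntegral ℤ ((3 : ℂ) ^ K' * coeff n g))
    (hg : (D.c : ℂ) • (PowerSeries.map (algebraMap ℚ ℂ) z * g) =
      PowerSeries.map (algebraMap ℚ ℂ) (W.formalExp.subst ((D.c : ℚ) • lSeriesLog a)) * h) :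
    ∃ (k : ℤ) (F : ℍ → ℂ), MDifferentiable 𝓘(ℂ) 𝓘(ℂ) F ∧
      (∀ γ : Gamma0 N, KummerPeriodTrivial D u γ → F ∣[k] (γ : SL(2, ℤ)) = F) ∧
      (∀ γ : Gamma0 N, F ∣[k] (γ : SL(2, ℤ)) = F → KummerPeriodTrivial D u γ) ∧
      (∀ g : SL(2, ℤ), ∃ C A m : ℝ, ∀ τ : ℍ, A ≤ τ.im → ‖(F ∣[k] g) τ‖ ≤ C * Real.exp (m * τ.im)) ∧
      (∃ b : ℕ → ℂ, (∀ n, IsIntegral ℤ (b n)) ∧ ∀ τ : ℍ,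
        HasSum (fun n : ℕ ↦ b n * Complex.exp (2 * Real.pi * Complex.I * (τ : ℂ) * n)) (F τ)) := by
  -- the lift in coordinates
  obtain ⟨m₁, m₂, hm⟩ := Submodule.mem_span_pair.mp (show 3 * u ∈ Submodule.span ℤ {D.L.ω₁, D.L.ω₂} from h3u)
  have hm' : 3 * u = m₁ * D.L.ω₁ + m₂ * D.L.ω₂ := by rw [← hm, zsmul_eq_mul, zsmul_eq_mul]
  -- (DICT)_ℂ
  obtain ⟨κ, hκ, B, hB⟩ := kummerMinimalDictionaryC D a ha X₀ Y₀ _ hu hm' hX hY rfl z hz h hh3 hh0 g hg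
  -- (RATB), (HOLB) with `C₀ = 3^{K'}κ`
  obtain ⟨m, Bn, Bd, bd, hBd0, hbd, hid⟩ := ParamPoleJ.kummerMinimalParamPresentation_holds W D a ha
  set C₀ : ℂ := (3 : ℂ) ^ K' * κ with hC₀
  have hC₀ne : C₀ ≠ 0 := mul_ne_zero (pow_ne_zero _ three_ne_zero) hκ
  obtain ⟨F, hFd, hFeq, hFgr⟩ := WitnessInvariance.kummerMinimalWitnessExtensionB_holds W D u hu m₁ m₂ hm' m Bn Bd hid C₀
  have hINV := WitnessInvariance.kummerMinimalWitnessInvarianceB_holds W D u hu m₁ m₂ hm' m Bd hBd0 C₀ hC₀ne F hFd hFeq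
  refine ⟨12 * (m : ℤ), F, hFd, fun γ hγ ↦ (hINV γ).1 hγ, fun γ hγ ↦ (hINV γ).2 hγ, hFgr, ?_⟩
  -- (QEXNB) with algebraic-integer coefficients, then (QXP)
  have hΦ : ∃ B : ℝ, ∀ τ : ℍ, B < τ.im → HasSum (fun n : ℕ ↦ ((3 : ℂ) ^ K' * coeff n g) * Function.Periodic.qParam 1 (τ : ℂ) ^ n)
      ((3 : ℂ) ^ K' * (κ * kummerMinBlock D u (m₁ * D.L.η₁ + m₂ * D.L.η₂) τ)) := by
    refine ⟨B, fun τ hτ ↦ ?_⟩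
    have hs := ((hB τ hτ).2.2).mul_left ((3 : ℂ) ^ K')
    simpa only [mul_assoc] using hs
  obtain ⟨b, B', hbint, hbB⟩ := integralQSeriesNearCuspB_algInt
    (fun τ ↦ (3 : ℂ) ^ K' * (κ * kummerMinBlock D u (m₁ * D.L.η₁ + m₂ * D.L.η₂) τ)) F Bd
    (fun n ↦ (3 : ℂ) ^ K' * coeff n g) bd hgint hΦ hbd ⟨B, fun τ hτ ↦ by
      rw [hFeq τ (hB τ hτ).1 (hB τ hτ).2.1, hC₀]; ring⟩
  exact ⟨b, hbint, fun τ ↦ QExpansionExtension.hasSum_exp_of_hasSum_of_lt_im hFd (b := b) hbB τ⟩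

/-! ### §3 The UDC glue with algebraic-integer coefficients -/

/-- **UDC glue, algebraic-integer coefficients**: a holomorphic `F` with stabiliser exactly the Kummer group of `u`, exponential growth at the cusps and
an algebraic-integer `q`-expansion on `ℍ`, together with Unbounded Denominators for algebraic-integer coefficients in the cell's unbundled rendering
(the body of an's `UnboundedDenominatorsWeightAlgInt k`, all weights), makes the Kummer character vanish on `Γ₀(N) ∩ Γ(M)` for some `M ≥ 1`
(NC-a `kummerCoverSubgroup_holds` supplies the finite-index group). CONDITIONAL on `hUDW` (= CDT Rem. 58–59, vendored).
[cite: CalegariDimitrovTang2025, Thm. 1.0.1 and Remarks 58–59] -/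
theorem kummerCongruence_of_witness_algInt [W.IsElliptic] [W.IsGloballyMinimal]
    (hUDW : ∀ (k : ℤ) (Γ : Subgroup SL(2, ℤ)), Γ.FiniteIndex → ∀ F : ℍ → ℂ, MDifferentiable 𝓘(ℂ) 𝓘(ℂ) F →
      (∀ γ ∈ Γ, F ∣[k] γ = F) →
      (∀ g : SL(2, ℤ), ∃ C A m : ℝ, ∀ τ : ℍ, A ≤ τ.im → ‖(F ∣[k] g) τ‖ ≤ C * Real.exp (m * τ.im)) →
      (∃ b : ℕ → ℂ, (∀ n, _root_.IsIntegral ℤ (b n)) ∧ ∀ τ : ℍ,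
        HasSum (fun n : ℕ => b n * Complex.exp (2 * Real.pi * Complex.I * (τ : ℂ) * n)) (F τ)) →
      ∃ M : ℕ, 0 < M ∧ ∀ γ ∈ CongruenceSubgroup.Gamma M, F ∣[k] γ = F)
    (D : ModularParametrizationData W N) (hopt : ∀ z ∈ D.L.lattice, ∃ w ∈ periodLattice D.f, z = D.c * w)
    {u : ℂ} (hu : u ∉ D.L.lattice) (h3u : 3 * u ∈ D.L.lattice) {k : ℤ} {F : ℍ → ℂ} (hhol : MDifferentiable 𝓘(ℂ) 𝓘(ℂ) F)
    (hinv : ∀ γ : Gamma0 N, KummerPeriodTrivial D u γ → F ∣[k] (γ : SL(2, ℤ)) = F)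
    (hstab : ∀ γ : Gamma0 N, F ∣[k] (γ : SL(2, ℤ)) = F → KummerPeriodTrivial D u γ)
    (hgrowth : ∀ g : SL(2, ℤ), ∃ C A m : ℝ, ∀ τ : ℍ, A ≤ τ.im → ‖(F ∣[k] g) τ‖ ≤ C * Real.exp (m * τ.im))
    (hq : ∃ b : ℕ → ℂ, (∀ n, IsIntegral ℤ (b n)) ∧ ∀ τ : ℍ,
      HasSum (fun n : ℕ ↦ b n * Complex.exp (2 * Real.pi * Complex.I * (τ : ℂ) * n)) (F τ)) :
    ∃ M : ℕ, 0 < M ∧ ∀ γ : Gamma0 N, (γ : SL(2, ℤ)) ∈ CongruenceSubgroup.Gamma M → KummerPeriodTrivial D u γ := by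
  obtain ⟨Γ, hmem, hle, hfi, -, -⟩ := kummerCoverSubgroup_holds W D hopt u hu h3u
  have hΓinv : ∀ γ ∈ Γ, F ∣[k] γ = F := by
    intro γ hγ
    have hγ0 : γ ∈ Gamma0 N := hle hγ
    exact hinv ⟨γ, hγ0⟩ ((hmem ⟨γ, hγ0⟩).mp hγ)
  obtain ⟨M, hM, hcong⟩ := hUDW k Γ hfi F hhol hΓinv hgrowth hq
  exact ⟨M, hM, fun γ hγ ↦ hstab γ (hcong _ hγ)⟩

/-! ### §4 (AN♮)_K modulo (INT)_K -/

/-- **(AN♮)_K modulo (INT)_K.**  Unbounded Denominators with algebraic-integer coefficients (all weights; the body of an's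
`UnboundedDenominatorsWeightAlgInt`) ⟹ for an optimal datum, a `K`-rational point `T = (X₀, Y₀)` of order `3` with rational abscissa, an analytic
lift `u`, THE germ `z`, a complex normalised cube root `h` of `Θ_T` and a minimal renormalisation `g` of `h` with `3^{K'}gₙ ∈ ℤ̄` (the output of
(INT)_K): the Kummer character of `u` vanishes on `Γ₀(N) ∩ Γ(M)` for some `M ≥ 1`.  CONDITIONAL on `hUDW`; with p2's
`UDWOfCDT.unboundedDenominatorsWeightAlgInt_of_CDT_algInt` (p734175) that input is the vendored CDT fact. [folklore] -/
theorem kummerCongruenceK_of_UDW_algInt_of_minimalCubeRoot [W.IsElliptic] [W.IsGloballyMinimal]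
    (hUDW : ∀ (k : ℤ) (Γ : Subgroup SL(2, ℤ)), Γ.FiniteIndex → ∀ F : ℍ → ℂ, MDifferentiable 𝓘(ℂ) 𝓘(ℂ) F →
      (∀ γ ∈ Γ, F ∣[k] γ = F) →
      (∀ g : SL(2, ℤ), ∃ C A m : ℝ, ∀ τ : ℍ, A ≤ τ.im → ‖(F ∣[k] g) τ‖ ≤ C * Real.exp (m * τ.im)) →
      (∃ b : ℕ → ℂ, (∀ n, _root_.IsIntegral ℤ (b n)) ∧ ∀ τ : ℍ,
        HasSum (fun n : ℕ => b n * Complex.exp (2 * Real.pi * Complex.I * (τ : ℂ) * n)) (F τ)) →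
      ∃ M : ℕ, 0 < M ∧ ∀ γ ∈ CongruenceSubgroup.Gamma M, F ∣[k] γ = F)
    (D : ModularParametrizationData W N) (a : ℕ → ℤ) (ha : ∀ n, (a n : ℂ) = cuspCoeff D.f n)
    (hopt : ∀ z ∈ D.L.lattice, ∃ w ∈ periodLattice D.f, z = D.c * w)
    (X₀ : ℚ) (Y₀ : ℂ) {u : ℂ} (hu : u ∉ D.L.lattice) (h3u : 3 * u ∈ D.L.lattice)
    (hX : (D.c : ℂ) ^ 2 * ℘[D.L] u = (X₀ : ℂ)) (hY : (D.c : ℂ) ^ 3 * ℘'[D.L] u / 2 = Y₀)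
    (z : ℚ⟦X⟧) (hz : IsParamGerm W D.c a z) (h : ℂ⟦X⟧)
    (hh3 : h ^ 3 = PowerSeries.map (algebraMap ℚ ℂ) ((shortModel W D.c).formalYMulCube.subst z)
            - Y₀ • PowerSeries.map (algebraMap ℚ ℂ) (z ^ 3)
            - ((3 * (X₀ : ℂ) ^ 2 + ((shortModel W D.c).a₄ : ℂ)) / (2 * Y₀)) •
                PowerSeries.map (algebraMap ℚ ℂ) ((shortModel W D.c).formalXMulSq.subst z * z - X₀ • z ^ 3))
    (hh0 : constantCoeff h = -1) (g : ℂ⟦X⟧) (K' : ℕ) (hgint : ∀ n, IsIntegral ℤ ((3 : ℂ) ^ K' * coeff n g))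
    (hg : (D.c : ℂ) • (PowerSeries.map (algebraMap ℚ ℂ) z * g) =
      PowerSeries.map (algebraMap ℚ ℂ) (W.formalExp.subst ((D.c : ℚ) • lSeriesLog a)) * h) :
    ∃ M : ℕ, 0 < M ∧ ∀ γ : Gamma0 N, (γ : SL(2, ℤ)) ∈ CongruenceSubgroup.Gamma M → KummerPeriodTrivial D u γ := by
  obtain ⟨k, F, hhol, hinv, hstab, hgrowth, hq⟩ :=
    exists_kummerWitness_algInt D a ha X₀ Y₀ hu h3u hX hY z hz h hh3 hh0 g K' hgint hg
  exact kummerCongruence_of_witness_algInt hUDW D hopt hu h3u hhol hinv hstab hgrowth hq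

/-- **(AN♮)_K modulo (INT)_K, UDC input DISCHARGED from the vendored CDT fact** (`CalegariDimitrovTang2025_unboundedDenominators_algInt` via p734175).
CONDITIONAL on that Literature fact (taken as the hypothesis `hCDT`). [cite: CalegariDimitrovTang2025, Thm. 1.0.1 and Remarks 58–59] -/
theorem kummerCongruenceK_of_CDT_algInt_of_minimalCubeRoot [W.IsElliptic] [W.IsGloballyMinimal]
    (hCDT : Literature.NumberTheory.Automorphic.CalegariDimitrovTang2025_unboundedDenominators_algInt)
    (D : ModularParametrizationData W N) (a : ℕ → ℤ) (ha : ∀ n, (a n : ℂ) = cuspCoeff D.f n)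
    (hopt : ∀ z ∈ D.L.lattice, ∃ w ∈ periodLattice D.f, z = D.c * w)
    (X₀ : ℚ) (Y₀ : ℂ) {u : ℂ} (hu : u ∉ D.L.lattice) (h3u : 3 * u ∈ D.L.lattice)
    (hX : (D.c : ℂ) ^ 2 * ℘[D.L] u = (X₀ : ℂ)) (hY : (D.c : ℂ) ^ 3 * ℘'[D.L] u / 2 = Y₀)
    (z : ℚ⟦X⟧) (hz : IsParamGerm W D.c a z) (h : ℂ⟦X⟧)
    (hh3 : h ^ 3 = PowerSeries.map (algebraMap ℚ ℂ) ((shortModel W D.c).formalYMulCube.subst z)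
            - Y₀ • PowerSeries.map (algebraMap ℚ ℂ) (z ^ 3)
            - ((3 * (X₀ : ℂ) ^ 2 + ((shortModel W D.c).a₄ : ℂ)) / (2 * Y₀)) •
                PowerSeries.map (algebraMap ℚ ℂ) ((shortModel W D.c).formalXMulSq.subst z * z - X₀ • z ^ 3))
    (hh0 : constantCoeff h = -1) (g : ℂ⟦X⟧) (K' : ℕ) (hgint : ∀ n, IsIntegral ℤ ((3 : ℂ) ^ K' * coeff n g))
    (hg : (D.c : ℂ) • (PowerSeries.map (algebraMap ℚ ℂ) z * g) =
      PowerSeries.map (algebraMap ℚ ℂ) (W.formalExp.subst ((D.c : ℚ) • lSeriesLog a)) * h) :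
    ∃ M : ℕ, 0 < M ∧ ∀ γ : Gamma0 N, (γ : SL(2, ℤ)) ∈ CongruenceSubgroup.Gamma M → KummerPeriodTrivial D u γ :=
  kummerCongruenceK_of_UDW_algInt_of_minimalCubeRoot
    (fun k ↦ UDWOfCDT.unboundedDenominatorsWeightAlgInt_of_CDT_algInt hCDT k) D a ha hopt X₀ Y₀ hu h3u hX hY z hz h hh3 hh0
    g K' hgint hg

/-! ### §5 BY NAME on an's `ManinAdditive.UDCKummerLineK` -/

section ByName

open Summit.BirchSwinnertonDyer.Rank1Residual.ManinAdditive.UDCKummerLineK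

/-- **The `K`-line's printed input BY NAME**: `∀ k, UDCKummerLineK.UnboundedDenominatorsWeightAlgInt k` from the vendored CDT fact with
algebraic-integer coefficients (p2's `UDWOfCDT.unboundedDenominatorsWeightAlgInt_of_CDT_algInt`, p734175, read on the named def).
[cite: CalegariDimitrovTang2025, Thm. 1.0.1 and Remarks 58–59] -/
theorem unboundedDenominatorsWeightAlgInt_of_CDT_algInt'
    (hCDT : Literature.NumberTheory.Automorphic.CalegariDimitrovTang2025_unboundedDenominators_algInt) (k : ℤ) :
    UnboundedDenominatorsWeightAlgInt k :=
  fun Γ hΓ F hF hinv hgr hq ↦ UDWOfCDT.unboundedDenominatorsWeightAlgInt_of_CDT_algInt hCDT k Γ hΓ F hF hinv hgr hq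

/-- **(AN♮)_K BY NAME modulo (INT)_K**: `KummerCubeRootCongruenceOfBoundedKOfUDC` follows from the minimal-cube-root integrality statement (INT)_K
in p3 g16's interface (hypothesis `hINT`, stated over an's defs): for a `K`-point of order `3` with rational abscissa, THE germ, a normalised complex
cube root `h` of `kummerCubeSeriesC` that is `IsThreeAdicallyBoundedAlg`, there is a minimal renormalisation `g` (`c·(z·g) = z_W·h`, `g(0) = −1`) with
`3^{K'}gₙ` algebraic integers.  CONDITIONAL on `hINT` only. [folklore] -/
theorem kummerCubeRootCongruenceOfBoundedKOfUDC_of_minimalCubeRootK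
    (hINT : ∀ (W : WeierstrassCurve ℚ) [W.IsElliptic] [W.IsGloballyMinimal] {N : ℕ} [NeZero N]
      (D : ModularParametrizationData W N) (a : ℕ → ℤ), (∀ n, (a n : ℂ) = cuspCoeff D.f n) →
      ∀ (X₀ : ℚ) (Y₀ : ℂ), IsShortThreeTorsionC W D.c X₀ Y₀ →
      ∀ z : ℚ⟦X⟧, IsParamGerm W D.c a z →
      ∀ h : ℂ⟦X⟧, h ^ 3 = kummerCubeSeriesC W D.c X₀ Y₀ z → constantCoeff h = -1 → IsThreeAdicallyBoundedAlg h →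
      ∃ (g : ℂ⟦X⟧) (K' : ℕ), (∀ n, IsIntegral ℤ ((3 : ℂ) ^ K' * coeff n g)) ∧ constantCoeff g = -1 ∧
        (D.c : ℂ) • (PowerSeries.map (algebraMap ℚ ℂ) z * g) =
          PowerSeries.map (algebraMap ℚ ℂ) (W.formalExp.subst ((D.c : ℚ) • lSeriesLog a)) * h) :
    KummerCubeRootCongruenceOfBoundedKOfUDC := by
  intro hUDW W _ _ N _ D a ha hopt X₀ Y₀ hT u hu h3u hX hY z hz h hh3 hh0 hbd
  obtain ⟨g, K', hgint, -, hg⟩ := hINT W D a ha X₀ Y₀ hT z hz h hh3 hh0 hbd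
  exact kummerCongruenceK_of_UDW_algInt_of_minimalCubeRoot (fun k ↦ hUDW k) D a ha hopt X₀ Y₀ hu h3u hX hY z hz h hh3 hh0
    g K' hgint hg

/-- **(AN)_K BY NAME modulo (INT)_K, UDC input discharged**: `KummerCubeRootCongruenceOfBoundedK` from the vendored CDT fact (algebraic-integer
coefficients) and (INT)_K.  CONDITIONAL on both hypotheses. [cite: CalegariDimitrovTang2025, Thm. 1.0.1 and Remarks 58–59] -/
theorem kummerCubeRootCongruenceOfBoundedK_of_CDT_algInt_of_minimalCubeRootK
    (hCDT : Literature.NumberTheory.Automorphic.CalegariDimitrovTang2025_unboundedDenominators_algInt)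
    (hINT : ∀ (W : WeierstrassCurve ℚ) [W.IsElliptic] [W.IsGloballyMinimal] {N : ℕ} [NeZero N]
      (D : ModularParametrizationData W N) (a : ℕ → ℤ), (∀ n, (a n : ℂ) = cuspCoeff D.f n) →
      ∀ (X₀ : ℚ) (Y₀ : ℂ), IsShortThreeTorsionC W D.c X₀ Y₀ →
      ∀ z : ℚ⟦X⟧, IsParamGerm W D.c a z →
      ∀ h : ℂ⟦X⟧, h ^ 3 = kummerCubeSeriesC W D.c X₀ Y₀ z → constantCoeff h = -1 → IsThreeAdicallyBoundedAlg h →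
      ∃ (g : ℂ⟦X⟧) (K' : ℕ), (∀ n, IsIntegral ℤ ((3 : ℂ) ^ K' * coeff n g)) ∧ constantCoeff g = -1 ∧
        (D.c : ℂ) • (PowerSeries.map (algebraMap ℚ ℂ) z * g) =
          PowerSeries.map (algebraMap ℚ ℂ) (W.formalExp.subst ((D.c : ℚ) • lSeriesLog a)) * h) :
    KummerCubeRootCongruenceOfBoundedK :=
  kummerCubeRootCongruenceOfBoundedKOfUDC_of_minimalCubeRootK hINT (unboundedDenominatorsWeightAlgInt_of_CDT_algInt' hCDT)

end ByName

end Summit.BirchSwinnertonDyer.BirchSwinnertonDyer.Theorems.ManinLocalTwoThree.KLine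

end
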